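import Mathlib.Analysis.Matrix.Spectrum
import Mathlib.Analysis.Matrix.Order
import Mathlib.LinearAlgebra.Matrix.SchurComplement
import Mathlib.MeasureTheory.Measure.Lebesgue.EqHaar
import Literature.Probability.RandomMatrix.LovasAndaiDefectFunctionProofs
import Literature.Probability.RandomMatrix.TwoQubitSeparabilityVolumesRebitFibreProofs

/-!
# Lovas–Andai 2017 on the maximally mixed fibre — the `Z`-sections (proofs, part 2)

Towards `LovasAndai2017_rebit_fibre_separability_probability_holds`
(`Literature/Probability/RandomMatrix/TwoQubitSeparabilityVolumes.lean`). This file formalizes the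
linear-algebra core of [LovasAndai2017, proof of Theorem 1] specialised to `D = ½·1₂`
(Corollary 2): for a fixed first block `X` of the fibre chart `ρ = [[X, Z], [Zᵀ, ½ − X]]`,

* `posDef_fromBlocks₁₁_iff` — the Schur complement criterion for positive DEFINITENESS
  (Lovas–Andai's Lemma 1; Mathlib has the semidefinite version), whence
  `posDef_rebitFibreMatrix_iff` : `ρ ≻ 0 ↔ X ≻ 0 ∧ (½−X) − ZᵀX⁻¹Z ≻ 0` and
  `posDef_half_sub_rebitFibreMatrix_iff` : `½ − ρ ≻ 0 ↔ X ≻ 0 ∧ (½−X) − ZX⁻¹Zᵀ ≻ 0`;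
* `exists_factors` — for `0 ≺ X ≺ ½` the spectral decomposition `X = U diag(λ) Uᵀ` gives
  `P = U diag(√λ)`, `Q = U diag(√(½−λ))`, `N = diag(√((½−λ)/λ))` with `X = PPᵀ`,
  `½ − X = QQᵀ = PN²Pᵀ`, `QᵀX⁻¹Q = N²`, and `N⁻¹YN = [[y₀₀, εy₀₁],[y₁₀/ε, y₁₁]]`,
  `ε² = λ₀(½−λ₁)/(λ₁(½−λ₀))`;
* `schur₁_conj`, `schur₂_conj` — under `Z = PYQᵀ`: `(½−X) − ZᵀX⁻¹Z = Q(1 − YᵀY)Qᵀ` and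
  `(½−X) − ZX⁻¹Zᵀ = (PN)(1 − ỸỸᵀ)(PN)ᵀ`, `Ỹ = N⁻¹YN` — this is Lovas–Andai's substitution
  `X ↦ D₁^{-1/2} C D₂^{-1/2}` and their `‖(V*)⁻¹ X V‖ < 1`, with `V` diagonal because `D₁` and
  `D₂ = ½ − D₁` commute;
* `fibre_sections` — hence the `Z`-sections of `{ρ ≻ 0}` and of `{0 ≺ ρ ≺ ½}` are the images of the
  operator-norm ball and of the doubly constrained ball of `χ₁(ε)` under `Y ↦ PYQᵀ`
  (matrix `P ⊗ Q` on the entry space `ℝ⁴`, determinant `det X · det(½−X)`):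
  `vol = det X det(½−X) · χ₁(1)` resp. `· χ₁(ε)` (`lovasAndaiChiOne`).

## References

* [LovasAndai2017] A. Lovas, A. Andai, J. Phys. A 50 (2017) 295303, Lemma 1, Theorem 1 (proof),
  Corollary 2. arXiv:1610.01410.
-/

noncomputable section

open Matrix
open scoped Matrix

namespace Literature.Probability.RandomMatrix.LovasAndai

/-- **Schur complement criterion for positive definiteness** (Lovas–Andai's Lemma 1): for real
blocks, `[[A, B], [Bᵀ, D]] ≻ 0 ↔ A ≻ 0 ∧ D − Bᵀ A⁻¹ B ≻ 0`. (Mathlib has the positive-semidefinite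
version `Matrix.PosDef.fromBlocks₁₁`; we upgrade it through
`det [[A,B],[Bᵀ,D]] = det A · det (D − BᵀA⁻¹B)`.) [cite: LovasAndai2017, Lemma 1] -/
theorem posDef_fromBlocks₁₁_iff {m n : Type*} [Fintype m] [Fintype n] [DecidableEq m]
    [DecidableEq n] (A : Matrix m m ℝ) (B : Matrix m n ℝ) (D : Matrix n n ℝ) :
    (Matrix.fromBlocks A B Bᵀ D).PosDef ↔ A.PosDef ∧ (D - Bᵀ * A⁻¹ * B).PosDef := by
  have hBH : Bᴴ = Bᵀ := conjTranspose_eq_transpose_of_trivial B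
  have hsub : (Matrix.fromBlocks A B Bᵀ D).submatrix Sum.inl Sum.inl = A := by
    ext i j
    rfl
  constructor
  · intro h
    have hA : A.PosDef := by
      have h1 := h.submatrix Sum.inl_injective
      rwa [hsub] at h1
    haveI := hA.isUnit.invertible
    refine ⟨hA, ?_⟩
    have hS : (D - Bᵀ * A⁻¹ * B).PosSemidef := by
      have := (Matrix.PosDef.fromBlocks₁₁ B D hA).mp (by rw [hBH]; exact h.posSemidef)
      rwa [hBH] at this
    refine hS.posDef_iff_det_ne_zero.mpr ?_
    have hne : (Matrix.fromBlocks A B Bᵀ D).det ≠ 0 := h.det_pos.ne'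
    rw [Matrix.det_fromBlocks₁₁, Matrix.invOf_eq_nonsing_inv] at hne
    exact right_ne_zero_of_mul hne
  · rintro ⟨hA, hS⟩
    haveI := hA.isUnit.invertible
    have hpsd : (Matrix.fromBlocks A B Bᵀ D).PosSemidef := by
      have := (Matrix.PosDef.fromBlocks₁₁ B D hA).mpr (by rw [hBH]; exact hS.posSemidef)
      rwa [hBH] at this
    refine hpsd.posDef_iff_det_ne_zero.mpr ?_
    rw [Matrix.det_fromBlocks₁₁, Matrix.invOf_eq_nonsing_inv]
    exact mul_ne_zero hA.det_pos.ne' hS.det_pos.ne'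

/-- For real `2 × 2` matrices, `1 − AᵀA ≻ 0 ↔ 1 − AAᵀ ≻ 0` (both say `‖A‖ < 1`; via the trace and
determinant criterion and Sylvester's `det(1 − AᵀA) = det(1 − AAᵀ)`). [folklore] -/
theorem posDef_one_sub_transpose_mul_iff_mul_transpose (A : Matrix (Fin 2) (Fin 2) ℝ) :
    (1 - Aᵀ * A).PosDef ↔ (1 - A * Aᵀ).PosDef := by
  have h1 : (1 - Aᵀ * A).IsHermitian := by
    refine Matrix.IsHermitian.sub Matrix.isHermitian_one ?_
    rw [Matrix.IsHermitian, Matrix.conjTranspose_eq_transpose_of_trivial, Matrix.transpose_mul,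
      Matrix.transpose_transpose]
  have h2 : (1 - A * Aᵀ).IsHermitian := by
    refine Matrix.IsHermitian.sub Matrix.isHermitian_one ?_
    rw [Matrix.IsHermitian, Matrix.conjTranspose_eq_transpose_of_trivial, Matrix.transpose_mul,
      Matrix.transpose_transpose]
  rw [Literature.Probability.RandomMatrix.posDef_fin_two_iff h1,
    Literature.Probability.RandomMatrix.posDef_fin_two_iff h2]
  have htr : (1 - Aᵀ * A).trace = (1 - A * Aᵀ).trace := by
    rw [Matrix.trace_sub, Matrix.trace_sub, Matrix.trace_mul_comm]
  have hdet : (1 - Aᵀ * A).det = (1 - A * Aᵀ).det := by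
    simp [Matrix.det_fin_two, Matrix.mul_apply, Fin.sum_univ_two]
    ring
  rw [htr, hdet]

/-- Positive definiteness is invariant under reindexing by an equivalence. [folklore] -/
theorem posDef_reindex_iff {m n : Type*} [Fintype m] [Fintype n] (e : m ≃ n)
    (M : Matrix m m ℝ) : (Matrix.reindex e e M).PosDef ↔ M.PosDef := by
  rw [Matrix.reindex_apply]
  constructor
  · intro h
    have := h.submatrix (e := e) e.injective
    simpa [Matrix.submatrix_submatrix] using this
  · intro h
    exact h.submatrix e.symm.injective

open Literature.Probability.RandomMatrix in
/-- The fibre chart as a reindexed block matrix `[[X, Z], [Zᵀ, ½ − X]]`. [folklore] -/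
theorem rebitFibreMatrix_eq_reindex (x : Fin 7 → ℝ) :
    rebitFibreMatrix x = Matrix.reindex finSumFinEquiv finSumFinEquiv
      (Matrix.fromBlocks !![x 0, x 2; x 2, x 1] !![x 3, x 4; x 5, x 6] (!![x 3, x 4; x 5, x 6])ᵀ
        !![1 / 2 - x 0, -x 2; -x 2, 1 / 2 - x 1]) := by
  ext i j
  fin_cases i <;> fin_cases j <;> rfl

open Literature.Probability.RandomMatrix in
/-- `½·1 − ρ(x)` as a reindexed block matrix `[[X, −Z], [−Zᵀ, ½ − X]]` with the BLOCK ROWS SWAPPED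
(so that `X` is the `(1,1)` block). [folklore] -/
theorem half_sub_rebitFibreMatrix_eq_reindex (x : Fin 7 → ℝ) :
    (2 : ℝ)⁻¹ • (1 : Matrix (Fin 4) (Fin 4) ℝ) - rebitFibreMatrix x =
      Matrix.reindex ((Equiv.sumComm (Fin 2) (Fin 2)).trans finSumFinEquiv)
        ((Equiv.sumComm (Fin 2) (Fin 2)).trans finSumFinEquiv)
      (Matrix.fromBlocks !![x 0, x 2; x 2, x 1] (-(!![x 3, x 4; x 5, x 6])ᵀ)
        (-(!![x 3, x 4; x 5, x 6])ᵀ)ᵀ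
        !![1 / 2 - x 0, -x 2; -x 2, 1 / 2 - x 1]) := by
  ext i j
  fin_cases i <;> fin_cases j <;>
    simp [rebitFibreMatrix, Matrix.smul_apply] <;> rfl

open Literature.Probability.RandomMatrix in
/-- **`ρ ≻ 0` on the fibre chart via the Schur complement**:
`ρ(x) ≻ 0 ↔ X ≻ 0 ∧ (½ − X) − Zᵀ X⁻¹ Z ≻ 0`.
[cite: LovasAndai2017, Lemma 1 and proof of Theorem 1] -/
theorem posDef_rebitFibreMatrix_iff (x : Fin 7 → ℝ) :
    (rebitFibreMatrix x).PosDef ↔ (!![x 0, x 2; x 2, x 1] : Matrix (Fin 2) (Fin 2) ℝ).PosDef ∧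
      (!![1 / 2 - x 0, -x 2; -x 2, 1 / 2 - x 1] -
        (!![x 3, x 4; x 5, x 6])ᵀ * (!![x 0, x 2; x 2, x 1])⁻¹ *
          !![x 3, x 4; x 5, x 6]).PosDef := by
  rw [rebitFibreMatrix_eq_reindex, posDef_reindex_iff, posDef_fromBlocks₁₁_iff]

open Literature.Probability.RandomMatrix in
/-- **`½·1 − ρ ≻ 0` on the fibre chart via the Schur complement**:
`½ − ρ(x) ≻ 0 ↔ X ≻ 0 ∧ (½ − X) − Z X⁻¹ Zᵀ ≻ 0`.
[cite: LovasAndai2017, Lemma 1 and proof of Theorem 1] -/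
theorem posDef_half_sub_rebitFibreMatrix_iff (x : Fin 7 → ℝ) :
    ((2 : ℝ)⁻¹ • (1 : Matrix (Fin 4) (Fin 4) ℝ) - rebitFibreMatrix x).PosDef ↔
      (!![x 0, x 2; x 2, x 1] : Matrix (Fin 2) (Fin 2) ℝ).PosDef ∧
      (!![1 / 2 - x 0, -x 2; -x 2, 1 / 2 - x 1] -
        !![x 3, x 4; x 5, x 6] * (!![x 0, x 2; x 2, x 1])⁻¹ *
          (!![x 3, x 4; x 5, x 6])ᵀ).PosDef := by
  rw [half_sub_rebitFibreMatrix_eq_reindex, posDef_reindex_iff, posDef_fromBlocks₁₁_iff,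
    Matrix.transpose_neg, Matrix.transpose_transpose]
  simp only [Matrix.neg_mul, Matrix.mul_neg, neg_neg]

/-! ### The linear change of variables `Y ↦ P Y Qᵀ` on the entry space `ℝ⁴` of `ℝ^{2×2}` -/

/-- The `2 × 2` matrix with entry vector `y` (same convention as `realMatrixTwo`). [folklore] -/
theorem realMatrixTwo_eq (y : Fin 4 → ℝ) :
    Literature.Probability.RandomMatrix.realMatrixTwo y = !![y 0, y 1; y 2, y 3] := rfl

/-- The `4 × 4` matrix (`= P ⊗ Q` in the row-major ordering of entries) of the linear map
`Y ↦ P Y Qᵀ` on `ℝ^{2×2} ≅ ℝ⁴`. Stated as an identity of `Matrix.toLin'`. [folklore] -/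
theorem toLin'_kron_apply (P Q : Matrix (Fin 2) (Fin 2) ℝ) (y : Fin 4 → ℝ) :
    Matrix.toLin' !![P 0 0 * Q 0 0, P 0 0 * Q 0 1, P 0 1 * Q 0 0, P 0 1 * Q 0 1;
                     P 0 0 * Q 1 0, P 0 0 * Q 1 1, P 0 1 * Q 1 0, P 0 1 * Q 1 1;
                     P 1 0 * Q 0 0, P 1 0 * Q 0 1, P 1 1 * Q 0 0, P 1 1 * Q 0 1;
                     P 1 0 * Q 1 0, P 1 0 * Q 1 1, P 1 1 * Q 1 0, P 1 1 * Q 1 1] y =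
      ![(P * !![y 0, y 1; y 2, y 3] * Qᵀ) 0 0, (P * !![y 0, y 1; y 2, y 3] * Qᵀ) 0 1,
        (P * !![y 0, y 1; y 2, y 3] * Qᵀ) 1 0, (P * !![y 0, y 1; y 2, y 3] * Qᵀ) 1 1] := by
  ext i
  fin_cases i <;>
    simp [Matrix.toLin'_apply, Matrix.mulVec, dotProduct, Fin.sum_univ_four, Matrix.mul_apply,
      Fin.sum_univ_two] <;> ring

/-- Its determinant is `(det P)² (det Q)²`. [folklore] -/
theorem det_kron (P Q : Matrix (Fin 2) (Fin 2) ℝ) :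
    (!![P 0 0 * Q 0 0, P 0 0 * Q 0 1, P 0 1 * Q 0 0, P 0 1 * Q 0 1;
        P 0 0 * Q 1 0, P 0 0 * Q 1 1, P 0 1 * Q 1 0, P 0 1 * Q 1 1;
        P 1 0 * Q 0 0, P 1 0 * Q 0 1, P 1 1 * Q 0 0, P 1 1 * Q 0 1;
        P 1 0 * Q 1 0, P 1 0 * Q 1 1, P 1 1 * Q 1 0, P 1 1 * Q 1 1] :
        Matrix (Fin 4) (Fin 4) ℝ).det = P.det ^ 2 * Q.det ^ 2 := by
  rw [Matrix.det_succ_row_zero]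
  simp [Fin.sum_univ_succ, Matrix.det_fin_three, Matrix.submatrix_apply, Fin.succAbove,
    Matrix.det_fin_two]
  ring

/-- **First Schur complement under `Z = P Y Qᵀ`**: if `X = P Pᵀ` with `P` invertible and
`W = Q Qᵀ`, then `W − Zᵀ X⁻¹ Z = Q (1 − YᵀY) Qᵀ`. [cite: LovasAndai2017, proof of Theorem 1] -/
theorem schur₁_conj {P Q X W Y : Matrix (Fin 2) (Fin 2) ℝ} (hP : IsUnit P.det)
    (hX : X = P * Pᵀ) (hW : W = Q * Qᵀ) :
    W - (P * Y * Qᵀ)ᵀ * X⁻¹ * (P * Y * Qᵀ) = Q * (1 - Yᵀ * Y) * Qᵀ := by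
  have hPT : IsUnit Pᵀ.det := by rwa [Matrix.det_transpose]
  have hinv : Pᵀ * (X⁻¹ * P) = 1 := by
    rw [hX, Matrix.mul_inv_rev, Matrix.mul_assoc, Matrix.nonsing_inv_mul _ hP, Matrix.mul_one,
      Matrix.mul_nonsing_inv _ hPT]
  rw [Matrix.transpose_mul, Matrix.transpose_mul, Matrix.transpose_transpose, hW]
  calc Q * Qᵀ - Qᵀᵀ * (Yᵀ * Pᵀ) * X⁻¹ * (P * Y * Qᵀ)
      = Q * Qᵀ - Q * (Yᵀ * ((Pᵀ * (X⁻¹ * P)) * (Y * Qᵀ))) := by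
        simp only [Matrix.mul_assoc, Matrix.transpose_transpose]
    _ = Q * (1 - Yᵀ * Y) * Qᵀ := by
        rw [hinv, Matrix.one_mul, Matrix.mul_sub, Matrix.sub_mul, Matrix.mul_one]
        simp only [Matrix.mul_assoc]

/-- **Second Schur complement under `Z = P Y Qᵀ`**: if moreover `Qᵀ X⁻¹ Q = N N` and
`W = P N N Pᵀ` with `N` invertible and symmetric, then
`W − Z X⁻¹ Zᵀ = (P N) (1 − (N⁻¹ Y N)(N⁻¹ Y N)ᵀ) (P N)ᵀ`.
[cite: LovasAndai2017, proof of Theorem 1] -/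
theorem schur₂_conj {P Q X W Y N : Matrix (Fin 2) (Fin 2) ℝ} (hN : IsUnit N.det) (hNT : Nᵀ = N)
    (hQXQ : Qᵀ * (X⁻¹ * Q) = N * N) (hW : W = P * (N * N) * Pᵀ) :
    W - (P * Y * Qᵀ) * X⁻¹ * (P * Y * Qᵀ)ᵀ =
      (P * N) * (1 - (N⁻¹ * Y * N) * (N⁻¹ * Y * N)ᵀ) * (P * N)ᵀ := by
  have e1 : N * (N⁻¹ * Y) = Y := by
    rw [← Matrix.mul_assoc, Matrix.mul_nonsing_inv _ hN, Matrix.one_mul]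
  have e2 : N⁻¹ * N = 1 := Matrix.nonsing_inv_mul _ hN
  rw [Matrix.transpose_mul, Matrix.transpose_mul, Matrix.transpose_transpose, hW,
    Matrix.transpose_mul, Matrix.transpose_mul, Matrix.transpose_mul, hNT,
    Matrix.transpose_nonsing_inv, hNT]
  calc P * (N * N) * Pᵀ - P * Y * Qᵀ * X⁻¹ * (Q * (Yᵀ * Pᵀ))
      = P * (N * N) * Pᵀ - P * (Y * ((Qᵀ * (X⁻¹ * Q)) * (Yᵀ * Pᵀ))) := by
        simp only [Matrix.mul_assoc]
    _ = P * N * (1 - N⁻¹ * Y * N * (N * (Yᵀ * N⁻¹))) * (N * Pᵀ) := by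
        rw [hQXQ, Matrix.mul_sub, Matrix.sub_mul, Matrix.mul_one]
        congr 1
        · simp only [Matrix.mul_assoc]
        · calc P * (Y * (N * N * (Yᵀ * Pᵀ)))
              = P * ((N * (N⁻¹ * Y)) * (N * (N * (Yᵀ * ((N⁻¹ * N) * Pᵀ))))) := by
                rw [e1, e2, Matrix.one_mul]; simp only [Matrix.mul_assoc]
            _ = P * N * (N⁻¹ * Y * N * (N * (Yᵀ * N⁻¹))) * (N * Pᵀ) := by
                simp only [Matrix.mul_assoc]

/-! ### Diagonalisation of `X` and the factors `P`, `Q`, `N` -/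

/-- **The factors of the change of variables.** For `0 ≺ X ≺ ½·1` (real symmetric `2 × 2`) there are
invertible `P`, `Q` and an invertible positive diagonal `N` with `X = PPᵀ`, `½ − X = QQᵀ = P N² Pᵀ`,
`Qᵀ X⁻¹ Q = N²`, `N⁻¹ Y N = [[y₀₀, ε y₀₁], [y₁₀/ε, y₁₁]]` for a ratio `ε > 0` of the diagonal
entries of
`N`, and `ε² = λ₀(½ − λ₁)/(λ₁(½ − λ₀))` for the eigenvalues `λ₀, λ₁ ∈ (0, ½)` of `X`
(`P = U diag(√λ)`, `Q = U diag(√(½−λ))`, `N = diag(√((½−λ)/λ))` for the spectral decomposition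
`X = U diag(λ) Uᵀ`).
[cite: LovasAndai2017, proof of Theorem 1 (substitution X = D₁^{-1/2} C D₂^{-1/2})] -/
theorem exists_factors {X : Matrix (Fin 2) (Fin 2) ℝ} (hX : X.PosDef)
    (hW : ((2 : ℝ)⁻¹ • (1 : Matrix (Fin 2) (Fin 2) ℝ) - X).PosDef) :
    ∃ (P Q N : Matrix (Fin 2) (Fin 2) ℝ) (ε l₀ l₁ : ℝ),
      IsUnit P.det ∧ IsUnit Q.det ∧ IsUnit N.det ∧ Nᵀ = N ∧
      X = P * Pᵀ ∧ (2 : ℝ)⁻¹ • 1 - X = Q * Qᵀ ∧ Qᵀ * (X⁻¹ * Q) = N * N ∧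
      (2 : ℝ)⁻¹ • 1 - X = P * (N * N) * Pᵀ ∧ 0 < ε ∧
      (∀ Y : Matrix (Fin 2) (Fin 2) ℝ, N⁻¹ * Y * N = !![Y 0 0, ε * Y 0 1; Y 1 0 / ε, Y 1 1]) ∧
      P.det ^ 2 * Q.det ^ 2 = X.det * ((2 : ℝ)⁻¹ • (1 : Matrix (Fin 2) (Fin 2) ℝ) - X).det ∧
      0 < l₀ ∧ l₀ < 1 / 2 ∧ 0 < l₁ ∧ l₁ < 1 / 2 ∧ l₀ + l₁ = X.trace ∧ l₀ * l₁ = X.det ∧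
      ε ^ 2 = l₀ * (1 / 2 - l₁) / (l₁ * (1 / 2 - l₀)) := by
  have hH : X.IsHermitian := hX.isHermitian
  set U : Matrix (Fin 2) (Fin 2) ℝ := (hH.eigenvectorUnitary : Matrix (Fin 2) (Fin 2) ℝ) with hU
  set l : Fin 2 → ℝ := hH.eigenvalues with hl
  have hstar : star U = Uᵀ := by
    rw [Matrix.star_eq_conjTranspose, Matrix.conjTranspose_eq_transpose_of_trivial]
  have hU1 : Uᵀ * U = 1 := by
    rw [← hstar, hU]; exact Unitary.coe_star_mul_self _
  have hU2 : U * Uᵀ = 1 := by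
    rw [← hstar, hU]; exact Unitary.coe_mul_star_self _
  have hXd : X = U * Matrix.diagonal l * Uᵀ := by
    conv_lhs => rw [hH.spectral_theorem, Unitary.conjStarAlgAut_apply]
    rw [← hU, hstar]
    rfl
  have hlpos : ∀ i, 0 < l i := fun i => hX.eigenvalues_pos i
  -- `½ − X` is congruent to `diag(½ − l)`
  have hWd : (2 : ℝ)⁻¹ • (1 : Matrix (Fin 2) (Fin 2) ℝ) - X =
      U * Matrix.diagonal (fun i => 1 / 2 - l i) * Uᵀ := by
    rw [hXd]
    have : Matrix.diagonal (fun i => 1 / 2 - l i) =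
        (2 : ℝ)⁻¹ • (1 : Matrix (Fin 2) (Fin 2) ℝ) - Matrix.diagonal l := by
      rw [Matrix.smul_one_eq_diagonal, Matrix.diagonal_sub]
      congr 1; funext i; norm_num
    rw [this, Matrix.mul_sub, Matrix.sub_mul, Matrix.mul_smul, Matrix.mul_one, Matrix.smul_mul, hU2]
  have hUunit : IsUnit U := (Matrix.isUnit_iff_isUnit_det _).mpr
    (IsUnit.of_mul_eq_one Uᵀ.det (by rw [← Matrix.det_mul, hU2, Matrix.det_one]))
  have hllt : ∀ i, l i < 1 / 2 := by
    have hdiag : (Matrix.diagonal (fun i => 1 / 2 - l i)).PosDef := by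
      have h := (Matrix.IsUnit.posDef_star_left_conjugate_iff hUunit
        (x := (2 : ℝ)⁻¹ • (1 : Matrix (Fin 2) (Fin 2) ℝ) - X)).mpr hW
      rw [hstar, hWd] at h
      have e : Uᵀ * (U * Matrix.diagonal (fun i => 1 / 2 - l i) * Uᵀ) * U =
          Matrix.diagonal (fun i => 1 / 2 - l i) := by
        calc Uᵀ * (U * Matrix.diagonal (fun i => 1 / 2 - l i) * Uᵀ) * U
            = (Uᵀ * U) * Matrix.diagonal (fun i => 1 / 2 - l i) * (Uᵀ * U) := by
              simp only [Matrix.mul_assoc]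
          _ = Matrix.diagonal (fun i => 1 / 2 - l i) := by rw [hU1, Matrix.one_mul, Matrix.mul_one]
      rwa [e] at h
    intro i
    have := (Matrix.posDef_diagonal_iff.mp hdiag) i
    linarith
  -- the factors
  set p : Fin 2 → ℝ := fun i => Real.sqrt (l i) with hp
  set q : Fin 2 → ℝ := fun i => Real.sqrt (1 / 2 - l i) with hq
  set nn : Fin 2 → ℝ := fun i => Real.sqrt ((1 / 2 - l i) / l i) with hnn
  have hp2 : ∀ i, p i * p i = l i := fun i => Real.mul_self_sqrt (hlpos i).le
  have hq2 : ∀ i, q i * q i = 1 / 2 - l i := fun i => Real.mul_self_sqrt (by linarith [hllt i])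
  have hnn2 : ∀ i, nn i * nn i = (1 / 2 - l i) / l i := fun i =>
    Real.mul_self_sqrt (div_nonneg (by linarith [hllt i]) (hlpos i).le)
  have hppos : ∀ i, 0 < p i := fun i => Real.sqrt_pos.mpr (hlpos i)
  have hqpos : ∀ i, 0 < q i := fun i => Real.sqrt_pos.mpr (by linarith [hllt i])
  have hnnpos : ∀ i, 0 < nn i := fun i =>
    Real.sqrt_pos.mpr (div_pos (by linarith [hllt i]) (hlpos i))
  refine ⟨U * Matrix.diagonal p, U * Matrix.diagonal q, Matrix.diagonal nn, nn 1 / nn 0, l 0, l 1,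
    ?_, ?_, ?_, Matrix.diagonal_transpose _, ?_, ?_, ?_, ?_, div_pos (hnnpos 1) (hnnpos 0), ?_, ?_,
    hlpos 0, hllt 0, hlpos 1, hllt 1, ?_, ?_, ?_⟩
  · -- IsUnit det P
    rw [Matrix.det_mul, Matrix.det_diagonal]
    refine (hUunit.map Matrix.detMonoidHom).mul (IsUnit.mk0 _ ?_)
    exact Finset.prod_ne_zero_iff.mpr fun i _ => (hppos i).ne'
  · rw [Matrix.det_mul, Matrix.det_diagonal]
    refine (hUunit.map Matrix.detMonoidHom).mul (IsUnit.mk0 _ ?_)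
    exact Finset.prod_ne_zero_iff.mpr fun i _ => (hqpos i).ne'
  · rw [Matrix.det_diagonal]
    exact IsUnit.mk0 _ (Finset.prod_ne_zero_iff.mpr fun i _ => (hnnpos i).ne')
  · -- X = P Pᵀ
    rw [Matrix.transpose_mul, Matrix.diagonal_transpose, hXd]
    have : Matrix.diagonal p * Matrix.diagonal p = Matrix.diagonal l := by
      rw [Matrix.diagonal_mul_diagonal]; congr 1; funext i; exact hp2 i
    calc U * Matrix.diagonal l * Uᵀ
        = U * (Matrix.diagonal p * Matrix.diagonal p) * Uᵀ := by rw [this]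
      _ = U * Matrix.diagonal p * (Matrix.diagonal p * Uᵀ) := by simp only [Matrix.mul_assoc]
  · -- ½ − X = Q Qᵀ
    rw [Matrix.transpose_mul, Matrix.diagonal_transpose, hWd]
    have : Matrix.diagonal q * Matrix.diagonal q = Matrix.diagonal (fun i => 1 / 2 - l i) := by
      rw [Matrix.diagonal_mul_diagonal]; congr 1; funext i; exact hq2 i
    calc U * Matrix.diagonal (fun i => 1 / 2 - l i) * Uᵀ
        = U * (Matrix.diagonal q * Matrix.diagonal q) * Uᵀ := by rw [this]
      _ = U * Matrix.diagonal q * (Matrix.diagonal q * Uᵀ) := by simp only [Matrix.mul_assoc]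
  · -- Qᵀ X⁻¹ Q = N N
    have hXinv : X⁻¹ = U * Matrix.diagonal (fun i => (l i)⁻¹) * Uᵀ := by
      refine Matrix.inv_eq_left_inv ?_
      rw [hXd]
      calc U * Matrix.diagonal (fun i => (l i)⁻¹) * Uᵀ * (U * Matrix.diagonal l * Uᵀ)
          = U * (Matrix.diagonal (fun i => (l i)⁻¹) * ((Uᵀ * U) * Matrix.diagonal l)) * Uᵀ := by
            simp only [Matrix.mul_assoc]
        _ = 1 := by
            rw [hU1, Matrix.one_mul, Matrix.diagonal_mul_diagonal]
            have : Matrix.diagonal (fun i => (l i)⁻¹ * l i) = 1 := by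
              rw [← Matrix.diagonal_one]; congr 1; funext i; exact inv_mul_cancel₀ (hlpos i).ne'
            rw [this, Matrix.mul_one, hU2]
    rw [hXinv, Matrix.transpose_mul, Matrix.diagonal_transpose]
    calc Matrix.diagonal q * Uᵀ *
          (U * Matrix.diagonal (fun i => (l i)⁻¹) * Uᵀ * (U * Matrix.diagonal q))
        = Matrix.diagonal q * ((Uᵀ * U) * Matrix.diagonal (fun i => (l i)⁻¹) * (Uᵀ * U)) *
            Matrix.diagonal q := by simp only [Matrix.mul_assoc]
      _ = Matrix.diagonal nn * Matrix.diagonal nn := by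
          rw [hU1, Matrix.one_mul, Matrix.mul_one, Matrix.diagonal_mul_diagonal,
            Matrix.diagonal_mul_diagonal, Matrix.diagonal_mul_diagonal]
          congr 1; funext i
          rw [hnn2 i, ← hq2 i]
          ring
  · -- ½ − X = P N N Pᵀ
    rw [hWd, Matrix.transpose_mul, Matrix.diagonal_transpose]
    calc U * Matrix.diagonal (fun i => 1 / 2 - l i) * Uᵀ
        = U * (Matrix.diagonal p * (Matrix.diagonal nn * Matrix.diagonal nn) * Matrix.diagonal p) *
            Uᵀ := by
          rw [Matrix.diagonal_mul_diagonal, Matrix.diagonal_mul_diagonal,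
            Matrix.diagonal_mul_diagonal]
          have hfun : (fun i => 1 / 2 - l i) = fun i => p i * (nn i * nn i) * p i := by
            funext i
            rw [hnn2 i,
              show p i * ((1 / 2 - l i) / l i) * p i = (p i * p i) * ((1 / 2 - l i) / l i) by ring,
              hp2 i]
            field_simp [(hlpos i).ne']
          rw [hfun]
      _ = U * Matrix.diagonal p * (Matrix.diagonal nn * Matrix.diagonal nn) *
            (Matrix.diagonal p * Uᵀ) := by
          simp only [Matrix.mul_assoc]
  · -- N⁻¹ Y N in entries
    intro Y
    have hNinv : (Matrix.diagonal nn)⁻¹ = Matrix.diagonal (fun i => (nn i)⁻¹) := by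
      refine Matrix.inv_eq_left_inv ?_
      rw [Matrix.diagonal_mul_diagonal, ← Matrix.diagonal_one]
      congr 1; funext i; exact inv_mul_cancel₀ (hnnpos i).ne'
    rw [hNinv]
    have h0 : nn 0 ≠ 0 := (hnnpos 0).ne'
    have h1 : nn 1 ≠ 0 := (hnnpos 1).ne'
    ext i j
    fin_cases i <;> fin_cases j <;> simp [Matrix.diagonal_mul, Matrix.mul_diagonal] <;>
      field_simp
  · -- det identity
    have hdetU : U.det * U.det = 1 := by
      have := congrArg Matrix.det hU1
      rwa [Matrix.det_mul, Matrix.det_transpose, Matrix.det_one] at this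
    rw [hWd, hXd]
    simp only [Matrix.det_mul, Matrix.det_diagonal, Matrix.det_transpose, Fin.prod_univ_two]
    have e : (U.det * (p 0 * p 1)) ^ 2 * (U.det * (q 0 * q 1)) ^ 2 =
        (U.det * U.det) * (U.det * U.det) * ((p 0 * p 0) * (p 1 * p 1)) *
          ((q 0 * q 0) * (q 1 * q 1)) := by ring
    rw [e, hdetU, hp2, hp2, hq2, hq2]
    linear_combination
      (-(l 0 * l 1 * ((1 / 2 - l 0) * (1 / 2 - l 1)) * (U.det * U.det + 1))) * hdetU
  · -- trace
    rw [hH.trace_eq_sum_eigenvalues]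
    simp [Fin.sum_univ_two, hl]
  · rw [hH.det_eq_prod_eigenvalues]
    simp [Fin.prod_univ_two, hl]
  · -- ε²
    rw [div_pow, show nn 1 ^ 2 = nn 1 * nn 1 by ring, show nn 0 ^ 2 = nn 0 * nn 0 by ring,
      hnn2 1, hnn2 0]
    have h0 := (hlpos 0).ne'
    have h1 := (hlpos 1).ne'
    have h2 : 1 / 2 - l 0 ≠ 0 := by linarith [hllt 0]
    have h3 : 1 / 2 - l 1 ≠ 0 := by linarith [hllt 1]
    field_simp

/-! ### The sections of `{ρ ≻ 0}` and `{0 ≺ ρ ≺ ½}` over a fixed `X` -/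

open MeasureTheory in
open Literature.Probability.RandomMatrix in
/-- **Section volumes** [LovasAndai2017, proof of Theorem 1 and of Corollary 2, at `D = ½·1`]:
for fixed `0 ≺ X ≺ ½·1` the `Z`-sections of `{ρ ≻ 0}` and of `{0 ≺ ρ ≺ ½·1}` are the images of the
operator-norm ball `{1 − YᵀY ≻ 0}` and of Lovas–Andai's doubly constrained ball (the set of `χ₁(ε)`)
under `Y ↦ P Y Qᵀ`, of Jacobian `det X · det(½ − X)`; here `ε² = λ₀(½−λ₁)/(λ₁(½−λ₀))` for the
eigenvalues `λ₀, λ₁` of `X`. [cite: LovasAndai2017, Theorem 1 (proof) and Corollary 2] -/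
theorem fibre_sections {x' : Fin 3 → ℝ}
    (hX : (!![x' 0, x' 2; x' 2, x' 1] : Matrix (Fin 2) (Fin 2) ℝ).PosDef)
    (hW : (!![1 / 2 - x' 0, -x' 2; -x' 2, 1 / 2 - x' 1] : Matrix (Fin 2) (Fin 2) ℝ).PosDef) :
    ∃ ε l₀ l₁ : ℝ, 0 < ε ∧ 0 < l₀ ∧ l₀ < 1 / 2 ∧ 0 < l₁ ∧ l₁ < 1 / 2 ∧ l₀ + l₁ = x' 0 + x' 1 ∧
      l₀ * l₁ = x' 0 * x' 1 - x' 2 ^ 2 ∧ ε ^ 2 = l₀ * (1 / 2 - l₁) / (l₁ * (1 / 2 - l₀)) ∧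
      volume {z : Fin 4 → ℝ | (rebitFibreMatrix (Fin.append x' z)).PosDef} =
        ENNReal.ofReal ((x' 0 * x' 1 - x' 2 ^ 2) * ((1 / 2 - x' 0) * (1 / 2 - x' 1) - x' 2 ^ 2)) *
          lovasAndaiChiOne 1 ∧
      volume {z : Fin 4 → ℝ | (rebitFibreMatrix (Fin.append x' z)).PosDef ∧
          ((2 : ℝ)⁻¹ • (1 : Matrix (Fin 4) (Fin 4) ℝ) -
            rebitFibreMatrix (Fin.append x' z)).PosDef} =
        ENNReal.ofReal ((x' 0 * x' 1 - x' 2 ^ 2) * ((1 / 2 - x' 0) * (1 / 2 - x' 1) - x' 2 ^ 2)) *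
          lovasAndaiChiOne ε := by
  set Xm : Matrix (Fin 2) (Fin 2) ℝ := !![x' 0, x' 2; x' 2, x' 1] with hXm
  have hWm : (!![1 / 2 - x' 0, -x' 2; -x' 2, 1 / 2 - x' 1] : Matrix (Fin 2) (Fin 2) ℝ) =
      (2 : ℝ)⁻¹ • (1 : Matrix (Fin 2) (Fin 2) ℝ) - Xm := by
    ext i j; fin_cases i <;> fin_cases j <;> simp [hXm]
  rw [hWm] at hW
  obtain ⟨P, Q, N, ε, l₀, l₁, hPu, hQu, hNu, hNT, hXP, hWQ, hQXQ, hWP, hε, hconj, hdet,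
    hl₀, hl₀', hl₁, hl₁', htr, hdetl, hε2⟩ := exists_factors hX hW
  -- entries of the appended vector
  have e0 : ∀ z : Fin 4 → ℝ, Fin.append x' z (0 : Fin 7) = x' 0 := fun z => rfl
  have e1 : ∀ z : Fin 4 → ℝ, Fin.append x' z (1 : Fin 7) = x' 1 := fun z => rfl
  have e2 : ∀ z : Fin 4 → ℝ, Fin.append x' z (2 : Fin 7) = x' 2 := fun z => rfl
  have e3 : ∀ z : Fin 4 → ℝ, Fin.append x' z (3 : Fin 7) = z 0 := fun z => rfl
  have e4 : ∀ z : Fin 4 → ℝ, Fin.append x' z (4 : Fin 7) = z 1 := fun z => rfl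
  have e5 : ∀ z : Fin 4 → ℝ, Fin.append x' z (5 : Fin 7) = z 2 := fun z => rfl
  have e6 : ∀ z : Fin 4 → ℝ, Fin.append x' z (6 : Fin 7) = z 3 := fun z => rfl
  -- the linear change of variables and its determinant
  set L : (Fin 4 → ℝ) →ₗ[ℝ] (Fin 4 → ℝ) := Matrix.toLin'
    !![P 0 0 * Q 0 0, P 0 0 * Q 0 1, P 0 1 * Q 0 0, P 0 1 * Q 0 1;
       P 0 0 * Q 1 0, P 0 0 * Q 1 1, P 0 1 * Q 1 0, P 0 1 * Q 1 1;
       P 1 0 * Q 0 0, P 1 0 * Q 0 1, P 1 1 * Q 0 0, P 1 1 * Q 0 1;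
       P 1 0 * Q 1 0, P 1 0 * Q 1 1, P 1 1 * Q 1 0, P 1 1 * Q 1 1] with hL
  have hLdet : LinearMap.det L = P.det ^ 2 * Q.det ^ 2 := by rw [hL, LinearMap.det_toLin', det_kron]
  have hP0 : P.det ≠ 0 := hPu.ne_zero
  have hQ0 : Q.det ≠ 0 := hQu.ne_zero
  have hdetpos : 0 < P.det ^ 2 * Q.det ^ 2 :=
    mul_pos (lt_of_le_of_ne (sq_nonneg _) (Ne.symm (pow_ne_zero 2 hP0)))
      (lt_of_le_of_ne (sq_nonneg _) (Ne.symm (pow_ne_zero 2 hQ0)))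
  have hdet' : P.det ^ 2 * Q.det ^ 2 =
      (x' 0 * x' 1 - x' 2 ^ 2) * ((1 / 2 - x' 0) * (1 / 2 - x' 1) - x' 2 ^ 2) := by
    rw [hdet, ← hWm]
    simp [hXm, Matrix.det_fin_two]
    ring
  have hLne : LinearMap.det L ≠ 0 := by rw [hLdet]; exact hdetpos.ne'
  set Le : (Fin 4 → ℝ) ≃ₗ[ℝ] (Fin 4 → ℝ) := LinearMap.equivOfDetNeZero L hLne with hLe
  have hLe_apply : ∀ y, Le y = L y := fun y => rfl
  -- the matrix of `L y`
  have hmat : ∀ y : Fin 4 → ℝ, (!![L y 0, L y 1; L y 2, L y 3] : Matrix (Fin 2) (Fin 2) ℝ) =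
      P * !![y 0, y 1; y 2, y 3] * Qᵀ := by
    intro y
    rw [hL, toLin'_kron_apply]
    ext i j
    fin_cases i <;> fin_cases j <;> rfl
  -- units
  have hQunit : IsUnit Q := (Matrix.isUnit_iff_isUnit_det Q).mpr hQu
  have hPNunit : IsUnit (P * N) :=
    (Matrix.isUnit_iff_isUnit_det _).mpr (by rw [Matrix.det_mul]; exact hPu.mul hNu)
  have hstarQ : star Q = Qᵀ := by
    rw [Matrix.star_eq_conjTranspose, Matrix.conjTranspose_eq_transpose_of_trivial]
  have hstarPN : star (P * N) = (P * N)ᵀ := by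
    rw [Matrix.star_eq_conjTranspose, Matrix.conjTranspose_eq_transpose_of_trivial]
  -- the two conditions at `z = L y`
  have hcond1 : ∀ y : Fin 4 → ℝ, (rebitFibreMatrix (Fin.append x' (L y))).PosDef ↔
      (1 - (!![y 0, y 1; y 2, y 3] : Matrix (Fin 2) (Fin 2) ℝ)ᵀ *
        !![y 0, y 1; y 2, y 3]).PosDef := by
    intro y
    rw [posDef_rebitFibreMatrix_iff]
    simp only [e0, e1, e2, e3, e4, e5, e6]
    rw [hmat y, ← hXm, schur₁_conj hPu hXP (hWm.trans hWQ)]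
    rw [show Q * (1 - (!![y 0, y 1; y 2, y 3] : Matrix (Fin 2) (Fin 2) ℝ)ᵀ *
        !![y 0, y 1; y 2, y 3]) * Qᵀ =
      Q * (1 - (!![y 0, y 1; y 2, y 3] : Matrix (Fin 2) (Fin 2) ℝ)ᵀ *
        !![y 0, y 1; y 2, y 3]) * star Q by
      rw [hstarQ], Matrix.IsUnit.posDef_star_right_conjugate_iff hQunit]
    exact ⟨fun h => h.2, fun h => ⟨hX, h⟩⟩
  have hcond2 : ∀ y : Fin 4 → ℝ,
      ((2 : ℝ)⁻¹ • (1 : Matrix (Fin 4) (Fin 4) ℝ) - rebitFibreMatrix (Fin.append x' (L y))).PosDef ↔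
      (1 - (lovasAndaiConj ε y)ᵀ * lovasAndaiConj ε y).PosDef := by
    intro y
    rw [posDef_half_sub_rebitFibreMatrix_iff]
    simp only [e0, e1, e2, e3, e4, e5, e6]
    rw [hmat y, ← hXm, schur₂_conj hNu hNT hQXQ (hWm.trans hWP), hconj]
    have hY : (!![(!![y 0, y 1; y 2, y 3] : Matrix (Fin 2) (Fin 2) ℝ) 0 0,
        ε * (!![y 0, y 1; y 2, y 3] : Matrix (Fin 2) (Fin 2) ℝ) 0 1;
        (!![y 0, y 1; y 2, y 3] : Matrix (Fin 2) (Fin 2) ℝ) 1 0 / ε,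
        (!![y 0, y 1; y 2, y 3] : Matrix (Fin 2) (Fin 2) ℝ) 1 1] : Matrix (Fin 2) (Fin 2) ℝ) =
        lovasAndaiConj ε y := by
      ext i j; fin_cases i <;> fin_cases j <;> rfl
    rw [hY]
    rw [show P * N * (1 - lovasAndaiConj ε y * (lovasAndaiConj ε y)ᵀ) * (P * N)ᵀ =
      P * N * (1 - lovasAndaiConj ε y * (lovasAndaiConj ε y)ᵀ) * star (P * N) by rw [hstarPN],
      Matrix.IsUnit.posDef_star_right_conjugate_iff hPNunit,
      ← posDef_one_sub_transpose_mul_iff_mul_transpose]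
    exact ⟨fun h => h.2, fun h => ⟨hX, h⟩⟩
  -- the two sections as linear images
  have himage : ∀ (C : (Fin 4 → ℝ) → Prop), {z : Fin 4 → ℝ | C z} = L '' {y | C (L y)} := by
    intro C
    ext z
    constructor
    · intro hz
      refine ⟨Le.symm z, ?_, ?_⟩
      · show C (L (Le.symm z))
        rw [← hLe_apply, LinearEquiv.apply_symm_apply]
        exact hz
      · rw [← hLe_apply, LinearEquiv.apply_symm_apply]
    · rintro ⟨y, hy, rfl⟩
      exact hy
  refine ⟨ε, l₀, l₁, hε, hl₀, hl₀', hl₁, hl₁', ?_, ?_, hε2, ?_, ?_⟩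
  · rw [htr, Matrix.trace_fin_two]; rfl
  · rw [hdetl]; simp [hXm, Matrix.det_fin_two]; ring
  · rw [himage (fun z => (rebitFibreMatrix (Fin.append x' z)).PosDef)]
    simp only [hcond1]
    rw [MeasureTheory.Measure.addHaar_image_linearMap, hLdet, abs_of_pos hdetpos, hdet',
      lovasAndaiChiOne_one_eq]
    rfl
  · rw [himage (fun z => (rebitFibreMatrix (Fin.append x' z)).PosDef ∧
      ((2 : ℝ)⁻¹ • (1 : Matrix (Fin 4) (Fin 4) ℝ) - rebitFibreMatrix (Fin.append x' z)).PosDef)]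
    simp only [hcond1, hcond2]
    rw [MeasureTheory.Measure.addHaar_image_linearMap, hLdet, abs_of_pos hdetpos, hdet']
    rfl

end Literature.Probability.RandomMatrix.LovasAndai

end
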